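import Mathlib
import Literature.Barriers.ValiantsHypothesis.AlgebraicNaturalProofs
import Literature.Computability.AlgebraicComplexity.ReadOnceSingleSeedGenerator
import HarnessLib

/-!
# Crux `BarrierLever.SuccinctHittingSetsForVP` (stmt-ValiantsHypothesis-14610) — the SINGLE-SEED DOOR
for the read-once / PROP row (Minahan–Volkovich's one-seed generator in succinct form)

**What is proved (unconditional structural reduction; `--supports 14610`, it does NOT close the item).**
The read-once / PROP row of the 14610-side census ("`SmallCircuits ℂ n b` hits every nonzero
preprocessed read-once distinguisher") currently stands at `b = 3` via the Shpilka–Volkovich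
generator with `t = 4n` seeds (`stub_readOnceGenerator`, `readOnceHit_three`). Minahan–Volkovich 2017,
Thm. 20 — now in the tree in abstract form (`Literature.…ReadOnceSingleSeedGenerator`:
`IsPROP.aeval_singleSeed_ne_zero`) — needs ONE seed, provided the seed coordinates
`c_μ ∈ ℂ[Z]` are non-zero and SEPARATE DISJOINT FORMS (`SeparatesDisjointForms`). This file is the glue
with the generator principle:

* `SingleSeedDoor.eval_singleSeed` / `eval_aeval_singleSeed` : evaluating the single-seed image
  `D(y + W·c)` at `(u, w)` is evaluating `D` at the point `y_μ + w · c_μ(u)`;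
* `SingleSeedDoor.exists_eval₂_ne_zero` : a non-zero element of `ℂ[Z][W]` has a non-vanishing
  evaluation `(u, w)` (`MvPolynomial.funext` + finiteness of roots);
* `isSuccinctHittingSet_prop_of_singleSeed` : **if** some non-zero separating family
  `c : degLEMonomials n → ℂ[Z]` and base point `f₀` have ALL single-seed values
  `f₀ + w · Σ_μ c_μ(u) x^μ` realised in `SmallCircuits ℂ n b`, **then** `SmallCircuits ℂ n b` is a
  succinct hitting set for the PROP distinguishers (any size, any degree).

So the exponent of the read-once / PROP row equals the REALISABILITY exponent of any single separating
seed family. Honest status (val-np-p5 g20 memo LANDSCAPE-8749-g20.md §1c, §2): the only separating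
family known is Minahan–Volkovich's univariate Lagrange family (`separatesDisjointForms_lagrangeSeed`),
whose values cost ≈ `N = C(2n,n)` — useless for `SmallCircuits`; the cheap affine-letter seeds of the
`b = 3` proof (`…AffineSeeds`) do NOT separate disjoint forms for `n ≥ 3` (their coordinate functions
are the Lagrange fundamental polynomials of the Veronese `ν_n(P^n)` node set, and already two spaces of
quadrics in complementary halves of them meet for dimension reasons). No instance of the hypothesis
realisable in `SmallCircuits ℂ n 2` is known; the row stays at `b = 3`; the crux 14610 (FSV Question 6)
and 8745/8749 stay OPEN; nothing here bears on `VP ≠ VNP`.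

References: [MinahanVolkovich2017] D. Minahan, I. Volkovich, CCC 2017 (LIPIcs 79) 32, Thm. 20;
[ForbesShpilkaVolk2018] M. Forbes, A. Shpilka, B. L. Volk, Theory Comput. 14 (2018), §3
(generators ⇒ hitting), Construction 25, Question 6.
-/

-- layout Summits/ValiantsHypothesis/ValiantsHypothesis forces the duplicated namespace component
set_option linter.dupNamespace false

noncomputable section

namespace Summit.ValiantsHypothesis.ValiantsHypothesis.Theorems.BarrierLever.SuccinctHittingSetsForVP

open Literature.Barriers.ValiantsHypothesis Literature.Computability.AlgebraicComplexity MvPolynomial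

namespace SingleSeedDoor

variable {ι Z : Type}

/-- Evaluating one coordinate of the single-seed map: `(y_μ + W·c_μ)(u, w) = y_μ + w · c_μ(u)`.
[cite: MinahanVolkovich2017, Def. 14 (t = 1)] -/
theorem eval_singleSeed (y : ι → ℂ) (c : ι → MvPolynomial Z ℂ) (u : Z → ℂ) (w : ℂ) (μ : ι) :
    Polynomial.eval₂ (MvPolynomial.eval u) w (singleSeed y c μ) = y μ + w * MvPolynomial.eval u (c μ) := by
  simp only [singleSeed, Polynomial.eval₂_add, Polynomial.eval₂_mul, Polynomial.eval₂_C,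
    Polynomial.eval₂_X, MvPolynomial.algebraMap_eq, MvPolynomial.eval_C]
  ring

/-- Evaluation commutes with substitution: `D(y + W·c)(u, w) = D((y_μ + w·c_μ(u))_μ)`. [folklore] -/
theorem eval_aeval_singleSeed (y : ι → ℂ) (c : ι → MvPolynomial Z ℂ) (u : Z → ℂ) (w : ℂ)
    (D : MvPolynomial ι ℂ) :
    Polynomial.eval₂ (MvPolynomial.eval u) w (aeval (singleSeed y c) D) =
      MvPolynomial.eval (fun μ => y μ + w * MvPolynomial.eval u (c μ)) D := by
  have h : ((Polynomial.eval₂RingHom (MvPolynomial.eval u) w).comp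
      (aeval (singleSeed y c) : MvPolynomial ι ℂ →ₐ[ℂ] Polynomial (MvPolynomial Z ℂ)).toRingHom) =
      (MvPolynomial.eval fun μ => y μ + w * MvPolynomial.eval u (c μ)) := by
    refine MvPolynomial.ringHom_ext (fun a => ?_) (fun μ => ?_)
    · simp only [RingHom.coe_comp, Function.comp_apply, AlgHom.toRingHom_eq_coe, AlgHom.coe_toRingHom,
        MvPolynomial.algHom_C, Polynomial.algebraMap_apply, MvPolynomial.algebraMap_eq,
        Polynomial.coe_eval₂RingHom, Polynomial.eval₂_C, MvPolynomial.eval_C]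
    · simp only [RingHom.coe_comp, Function.comp_apply, AlgHom.toRingHom_eq_coe, AlgHom.coe_toRingHom,
        aeval_X, Polynomial.coe_eval₂RingHom, eval_singleSeed, MvPolynomial.eval_X]
  rw [← h]
  rfl

/-- A non-zero element of `ℂ[Z][W]` has a non-vanishing evaluation `(u, w)`: some coefficient is a
non-zero polynomial in `Z`, non-vanishing at some `u` (`MvPolynomial.funext`), and the resulting
non-zero univariate polynomial in `W` has a non-root (finitely many roots). [folklore] -/
theorem exists_eval₂_ne_zero {G : Polynomial (MvPolynomial Z ℂ)} (hG : G ≠ 0) :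
    ∃ (u : Z → ℂ) (w : ℂ), Polynomial.eval₂ (MvPolynomial.eval u) w G ≠ 0 := by
  obtain ⟨k, hk⟩ : ∃ k, G.coeff k ≠ 0 := by
    by_contra h
    push Not at h
    exact hG (Polynomial.ext fun k => by rw [h k, Polynomial.coeff_zero])
  obtain ⟨u, hu⟩ : ∃ u : Z → ℂ, MvPolynomial.eval u (G.coeff k) ≠ 0 := by
    by_contra h
    push Not at h
    exact hk (MvPolynomial.funext fun u => by rw [h u, map_zero])
  have hmap : G.map (MvPolynomial.eval u) ≠ 0 := fun h0 => by
    have := congrArg (fun q => q.coeff k) h0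
    simp only [Polynomial.coeff_map, Polynomial.coeff_zero] at this
    exact hu this
  obtain ⟨w, hw⟩ : ∃ w : ℂ, ¬ (G.map (MvPolynomial.eval u)).IsRoot w := by
    by_contra h
    push Not at h
    refine hmap (Polynomial.eq_zero_of_infinite_isRoot _ ?_)
    have hall : {x : ℂ | (G.map (MvPolynomial.eval u)).IsRoot x} = Set.univ :=
      Set.eq_univ_of_forall fun x => h x
    rw [hall]
    exact Set.infinite_univ
  refine ⟨u, w, ?_⟩
  rwa [Polynomial.IsRoot, Polynomial.eval_map] at hw

end SingleSeedDoor

open SingleSeedDoor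

/-- **The single-seed door for the read-once / PROP row** (crux stmt-ValiantsHypothesis-14610,
structural reduction). If a family `c : degLEMonomials n → ℂ[Z]` of non-zero seed coordinates
SEPARATES DISJOINT FORMS (Minahan–Volkovich's criterion) and every single-seed value
`f₀ + w · Σ_μ c_μ(u) x^μ` is the coefficient vector of a member of `SmallCircuits ℂ n b`, then
`SmallCircuits ℂ n b` hits every non-zero preprocessed read-once distinguisher: Minahan–Volkovich's
Thm. 20 (`IsPROP.aeval_singleSeed_ne_zero`, shift `y = coeff f₀`) gives `D(y + W·c) ≠ 0`, some
evaluation `(u, w)` is non-zero (`exists_eval₂_ne_zero`), and that value is `D` at the coefficient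
vector of the realising small circuit. No instance with `b = 2` is known (the univariate Lagrange family
costs `≈ C(2n,n)`; the affine-letter seeds do not separate disjoint forms for `n ≥ 3`).
[cite: MinahanVolkovich2017, Thm. 20] [cite: ForbesShpilkaVolk2018, §3 and Construction 25] -/
theorem isSuccinctHittingSet_prop_of_singleSeed {n b : ℕ} {Z : Type}
    (c : degLEMonomials n → MvPolynomial Z ℂ) (hc : ∀ μ, c μ ≠ 0)
    (hsep : SeparatesDisjointForms ℂ c) (f₀ : MvPolynomial (Fin n) ℂ)
    (hreal : ∀ (u : Z → ℂ) (w : ℂ), ∃ f ∈ SmallCircuits ℂ n b, ∀ μ : degLEMonomials n,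
      coeff (μ : Fin n →₀ ℕ) f = coeff (μ : Fin n →₀ ℕ) f₀ + w * MvPolynomial.eval u (c μ)) :
    IsSuccinctHittingSet (degLEMonomials n) (SmallCircuits ℂ n b)
      {D | ∃ S : Finset (degLEMonomials n), IsPROP S D} := by
  classical
  intro D hD hD0
  obtain ⟨S, hS⟩ := hD
  have hgen := hS.aeval_singleSeed_ne_zero hc hsep (fun μ => coeff (μ : Fin n →₀ ℕ) f₀) hD0
  obtain ⟨u, w, huw⟩ := exists_eval₂_ne_zero hgen
  obtain ⟨f, hf, hcoeff⟩ := hreal u w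
  refine ⟨f, hf, ?_⟩
  rw [eval_aeval_singleSeed] at huw
  have hpt : coeffVector (degLEMonomials n) f =
      fun μ : degLEMonomials n => coeff (μ : Fin n →₀ ℕ) f₀ + w * MvPolynomial.eval u (c μ) :=
    funext fun μ => by rw [coeffVector_apply, hcoeff μ]
  rwa [hpt]

end Summit.ValiantsHypothesis.ValiantsHypothesis.Theorems.BarrierLever.SuccinctHittingSetsForVP

end
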